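import Mathlib.MeasureTheory.Integral.DominatedConvergence
import Mathlib.MeasureTheory.Measure.Dirac
import Mathlib.Analysis.SpecialFunctions.Pow.Asymptotics
import Mathlib.Analysis.SpecialFunctions.Log.Basic
import HarnessLib

/-!
# Barrier: Oehme–Zimmermann superconvergence — in an asymptotically free gauge theory the gluon propagator has no positive Källén–Lehmann representation ("positivity versus colour antiscreening")

Barrier catalogue `Literature/Barriers/QuantumFields/` (D-0021), summit `QuantumFields`
(conjuncts `YangMills`, `QCD`). This file records the Oehme–Zimmermann obstruction (1980), as
reviewed by Alkofer–von Smekal (Phys. Rep. 2001, §2.3), to realising the Yang–Mills mass gap in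
the most naive way — as a massive transverse gluon, a one-particle pole of the (gauge-fixed)
gluon propagator in a positive-norm state space — and PROVES its measure-theoretic core: a
dressing function `Z(k²) = ∫ dρ(m²) k²/(k² + m²)` with a POSITIVE finite spectral measure tends
to the total mass `∫ dρ` at large `k²`, so it cannot be "superconvergent" (`Z(k²) → 0`) unless
`ρ = 0`; asymptotic freedom makes the Landau-gauge gluon dressing function superconvergent
(`Z ∝ (ln k²)^{−γ}`, `0 < γ < 1` for `N_f < 10`; proved superconvergent here for every `γ > 0`).

What the sources print (verbatim, Alkofer–von Smekal 2001):

* Abstract: "The apparent contradiction between positivity and colour antiscreening in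
  combination with BRS invariance in QCD is considered. Evidence for the violation of positivity
  by quarks and transverse gluons in the covariant gauge is collected, and it is argued that this
  is one manifestation of confinement."
* §2.3 "Positivity versus Colour Antiscreening": "we briefly review and discuss quite a
  long-known contradiction between asymptotic freedom, implying antiscreening of the colour
  charge in the sense of Källén, and the positivity of the spectral density for gluons in the
  covariant gauge [Oeh80]"; "In contrast, asymptotic freedom corresponds to the scaling limit
  `g₀ → 0`. Therefore, for `γ > 0` one has `Z₃ → ∞`, and from Eq. (true_sr) one thus concludes
  that the spectral density cannot be positive. In perturbative QCD in Landau gauge one has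
  `1 > γ > 0` for `N_f < 10` quark flavours. Then, `Z₃⁻¹ → 0` leads to the Oehme–Zimmermann
  superconvergence relation [Oeh80]"; "This has been interpreted as a manifestation of
  confinement from asymptotic freedom and unbroken BRS invariance, since the existence of a
  semi-definite physical space of transverse gluon states obtained after projecting out
  longitudinal gluon and ghost degrees of freedom would imply that `ρ(κ²) ≥ 0`"; the spectral
  representation of the gluon renormalisation function, "`Z(k², μ²) = ∫₀^∞ dm² k²/(k² + m²)
  ρ(m², μ², g)`", and "from Eq. (spec_Z) for `k² → ∞` one obtains
  `∫₀^∞ dm² ρ(m², μ² < ∞, g > 0) = 0`. Note that this last limit results by choosing a strictly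
  finite renormalisation point `μ²` and employing the limit `k²/μ² → ∞`. … The superconvergence
  relation might therefore be interpreted as a reincarnation of Haag's theorem"; in general
  linear covariant gauges "`ρ(k²) → −γ C_R(g², ξ) k⁻² (ln k²/μ²)^{−γ−1}` for `k² → ∞` … Here,
  `γ` is the same positive (for `N_f < 10`) anomalous dimension of the gluon field and `C_R` some
  positive constant. Therefore, `ρ(k²)` is shown not to be positive also in the general, linear
  covariant gauges." and "the requirement of an unbroken global gauge symmetry … is a necessary
  condition in the derivation of the superconvergence relations discussed in this section
  [Nis96]. This condition is violated in models with Higgs mechanism which prevents one from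
  concluding a positivity violation of the massive physical vector-states in the transverse
  gauge-boson correlations in that case."
* §2.1: "Confinement of quarks and transverse gluons is hereby attributed to violations of
  positivity which should result in indefinite spectral densities for their respective
  correlations … It has in fact been argued that such a violation of positivity … points in this
  argument which might be regarded as not absolutely conclusive are discussed further in
  Sec. 2.3."; §2.4: "Covariant quantum theories of gauge fields require indefinite metric
  spaces."

## Contents (all statements proved)

* `klDressing ρ k² = ∫ dρ(m²) k²/(k² + m²)` — the dressing function `Z(k²)` of a propagator
  with (unsubtracted) Källén–Lehmann measure `ρ` (AvS eq. for `Z(k², μ²)`);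
  `tendsto_klDressing`: for a finite measure carried by `m² ≥ 0`, `Z(k²) → ρ([0, ∞))`
  (dominated convergence).
* Technique class (explicit definition) `HasPositiveKallenLehmann Z` — `Z` is the dressing of a
  NON-ZERO POSITIVE FINITE spectral measure on `m² ≥ 0` (what a transverse gluon living in a
  semi-definite physical state space, e.g. a massive vector boson with positive residue, would
  have); `IsSuperconvergent Z := Z(k²) → 0`.
* `measure_eq_zero_of_isSuperconvergent`, `not_hasPositiveKallenLehmann_of_isSuperconvergent`
  (superconvergence ⇒ `ρ = 0`; hence the class is excluded).
* Non-vacuity and sharpness: `hasPositiveKallenLehmann_massivePole` (`Z = k²/(k² + M²)`,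
  measure `δ_{M²}`, is a member) and `not_isSuperconvergent_massivePole`;
  `isSuperconvergent_log_rpow_neg` (the asymptotically free shape `C (ln k²)^{−γ}`, `γ > 0`, is
  superconvergent) and `not_hasPositiveKallenLehmann_log_rpow_neg`.
* The barrier `OehmeZimmermannSuperconvergence` with its proof.
* Barrier audit (D-0021, 2026-08-14 — NARROWED in technique class, sharpened in scope): what
  superconvergence pins is the TOTAL SIGNED spectral weight and nothing more —
  `isSuperconvergent_klDressing_sub_iff` (for `ρ = ρ₊ − ρ₋` with finite parts: superconvergent
  iff `ρ₊([0,∞)) = ρ₋([0,∞))`), so a POSITIVE-residue massive one-particle pole on top of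
  negative continuum weight is superconvergent (`isSuperconvergent_pole_sub_klDressing`,
  `isSuperconvergent_massivePole_sub_massivePole`) — the shape of the lattice / functional
  Landau-gauge gluon spectral functions (Iritani–Suganuma–Iida 2009; Cyrol et al. 2018); in the
  linear covariant gauges `ξ > 0` the dressing function is NOT superconvergent (`−k²D → ξ/ξ₀`,
  sum rule `∫ρ = ξ/ξ₀`: Oehme–Xu 1994, Xu 1996 §2.3, Alkofer–von Smekal §2.3 eq. (OZ)) and every
  positive total weight is attained inside the positive class
  (`exists_hasPositiveKallenLehmann_tendsto`), so conjunct (i) is void there; in the other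
  direction the finiteness hypothesis is not load-bearing
  (`measure_eq_zero_of_isSuperconvergent_of_integrable`) and the gauge-invariant pinch-technique
  propagator is superconvergent as well (Cornwall 2013). Record:
  `OehmeZimmermannSuperconvergenceNarrow` (proved: `OehmeZimmermannSuperconvergenceNarrow_holds`,
  `OehmeZimmermannSuperconvergenceNarrow.toOehmeZimmermannSuperconvergence`).

## References

* R. Oehme, W. Zimmermann, *Quark and gluon propagators in quantum chromodynamics*, Phys. Rev.
  D 21 (1980) 471; *Gauge field propagator and the number of fermion fields*, ibid. 1661 — origin
  (titles; consulted through Alkofer–von Smekal 2001 §2.3, their [Oeh80]).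
* R. Alkofer, L. von Smekal, *The infrared behaviour of QCD Green's functions*, Phys. Rep. 353
  (2001) 281, arXiv:hep-ph/0007355 — Abstract, §2.1, §2.2, §2.3, §2.4, §5.2.3, §5.3.4.
* W. Xu, *Asymptotic Limits and Sum Rules for Propagators in Quantum Chromodynamics*, PhD thesis,
  University of Chicago (1996), arXiv:hep-th/9607045 — Abstract, §2.1–§2.3 (the general linear
  covariant gauges; contains R. Oehme, W. Xu, Phys. Lett. B 333 (1994) 172).
* T. Iritani, H. Suganuma, H. Iida, *Gluon-propagator functional form in the Landau gauge in
  SU(3) lattice QCD*, Phys. Rev. D 80 (2009) 114505, arXiv:0908.1311 — Abstract, §6.3.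
* A. K. Cyrol, J. M. Pawlowski, A. Rothkopf, N. Wink, *Reconstructing the gluon*, SciPost Phys.
  5 (2018) 065, arXiv:1804.00945 — §3, §4, §5.4, §6.
* J. M. Cornwall, *Positivity violations in QCD*, Mod. Phys. Lett. A 28 (2013) 1330035,
  arXiv:1310.7897 — Abstract, §2.1–§2.2.
* P. Lowdon, *Dyson–Schwinger equation constraints on the gluon propagator in BRST quantised
  QCD*, Phys. Lett. B 786 (2018) 399, arXiv:1801.09337 — §2.
* K.-I. Kondo, M. Watanabe, Y. Hayashi, R. Matsudo, Y. Suda, *Reflection positivity and complex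
  analysis of the Yang–Mills theory from a viewpoint of gluon confinement*, Eur. Phys. J. C 80
  (2020) 84, arXiv:1902.08894 — §1, §6.
* A. Maas, T. Mufti, *Two- and three-point functions in Landau gauge Yang–Mills–Higgs theory*,
  JHEP 04 (2014) 006, arXiv:1312.4873 — §4.1.
-/

noncomputable section

open MeasureTheory Filter Topology Set

namespace Literature.Barriers.QuantumFields

/-- **The dressing function of a Källén–Lehmann measure**: `Z(k²) = ∫ dρ(m²) k²/(k² + m²)`,
i.e. `k²` times the propagator `D(k²) = ∫ dρ(m²)/(k² + m²)` (Euclidean `k² > 0`; Alkofer–von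
Smekal's `Z(k², μ²) = ∫₀^∞ dm² k²/(k² + m²) ρ(m², μ², g)` with `dρ = ρ dm²`).
[cite: AlkoferVonSmekal2001, §2.3 (spectral representation of the gluon renormalisation function Z(k², μ²))] -/
def klDressing (ρ : Measure ℝ) (k2 : ℝ) : ℝ :=
  ∫ m2, k2 / (k2 + m2) ∂ρ

/-- For `m² ≥ 0` the integrand `k²/(k² + m²)` increases to `1` as `k² → ∞`. [folklore] -/
theorem tendsto_klIntegrand {m2 : ℝ} (hm : 0 ≤ m2) :
    Tendsto (fun k2 : ℝ => k2 / (k2 + m2)) atTop (𝓝 1) := by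
  have h1 : Tendsto (fun k2 : ℝ => m2 / (k2 + m2)) atTop (𝓝 0) :=
    tendsto_const_nhds.div_atTop (tendsto_atTop_add_const_right _ _ tendsto_id)
  have h2 : Tendsto (fun k2 : ℝ => 1 - m2 / (k2 + m2)) atTop (𝓝 (1 - 0)) := tendsto_const_nhds.sub h1
  rw [sub_zero] at h2
  refine h2.congr' ?_
  filter_upwards [eventually_gt_atTop 0] with k2 hk
  have : k2 + m2 ≠ 0 := by linarith
  field_simp
  ring

/-- For `k² > 0`, `m² ≥ 0`: `|k²/(k² + m²)| ≤ 1` (the dominating function). [folklore] -/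
theorem abs_klIntegrand_le_one {k2 m2 : ℝ} (hk : 0 < k2) (hm : 0 ≤ m2) : |k2 / (k2 + m2)| ≤ 1 := by
  have hden : 0 < k2 + m2 := by linarith
  rw [abs_of_nonneg (div_nonneg hk.le hden.le), div_le_one hden]
  linarith

/-- **Dominated convergence: the total spectral weight is the ultraviolet limit of the dressing
function.** For a finite measure `ρ` carried by `m² ≥ 0`, `Z(k²) = ∫ dρ k²/(k² + m²) → ρ([0, ∞))`
as `k² → ∞` — the content of Alkofer–von Smekal's passage from the spectral representation to
"`∫₀^∞ dm² ρ = lim` of `Z`". [cite: AlkoferVonSmekal2001, §2.3 (eqs. for Z(k², μ²) and its k² → ∞ limit)] -/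
theorem tendsto_klDressing (ρ : Measure ℝ) [IsFiniteMeasure ρ] (hsupp : ρ (Iio 0) = 0) :
    Tendsto (klDressing ρ) atTop (𝓝 (ρ.real univ)) := by
  have hae : ∀ᵐ m2 ∂ρ, 0 ≤ m2 := by
    rw [ae_iff]
    have : {a : ℝ | ¬ 0 ≤ a} = Iio 0 := by ext a; simp [not_le]
    rw [this]
    exact hsupp
  have hlim : Tendsto (fun k2 => ∫ m2, k2 / (k2 + m2) ∂ρ) atTop (𝓝 (∫ _m2, (1 : ℝ) ∂ρ)) := by
    refine tendsto_integral_filter_of_dominated_convergence (fun _ => (1 : ℝ)) ?_ ?_ ?_ ?_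
    · exact Eventually.of_forall fun k2 =>
        (measurable_const.div (measurable_const.add measurable_id)).aestronglyMeasurable
    · filter_upwards [eventually_gt_atTop 0] with k2 hk
      filter_upwards [hae] with m2 hm
      rw [Real.norm_eq_abs]
      exact abs_klIntegrand_le_one hk hm
    · exact integrable_const 1
    · filter_upwards [hae] with m2 hm using tendsto_klIntegrand hm
  have heq : klDressing ρ = fun k2 => ∫ m2, k2 / (k2 + m2) ∂ρ := rfl
  rw [heq]
  simpa [integral_const] using hlim

/-! ### Technique class, superconvergence, and the barrier -/

/-- **Technique class "positive Källén–Lehmann gluon" (explicit definition).** The (Euclidean,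
gauge-fixed) gluon dressing function `Z` is that of a NON-ZERO POSITIVE FINITE spectral measure
carried by `m² ≥ 0`: `Z(k²) = ∫ dρ(m²) k²/(k² + m²)` for `k² > 0`. This is what "the existence of
a semi-definite physical space of transverse gluon states obtained after projecting out
longitudinal gluon and ghost degrees of freedom would imply" (`ρ ≥ 0`), together with finiteness
of the total weight (the renormalised sum rule at finite `μ`); in particular it is what a massive
transverse gluon with positive residue — the naive realisation of a mass gap — would have
(`hasPositiveKallenLehmann_massivePole`).
[cite: AlkoferVonSmekal2001, §2.3 ("would imply that ρ(κ²) ≥ 0"; spectral representation of Z)] -/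
def HasPositiveKallenLehmann (Z : ℝ → ℝ) : Prop :=
  ∃ ρ : Measure ℝ, IsFiniteMeasure ρ ∧ ρ (Iio 0) = 0 ∧ ρ ≠ 0 ∧
    ∀ k2, 0 < k2 → Z k2 = klDressing ρ k2

/-- **Superconvergence** of a dressing function: `Z(k²) → 0` as `k² → ∞` — for a Källén–Lehmann
measure this reads `∫₀^∞ dm² ρ(m²) = 0` (Oehme–Zimmermann): "from Eq. (spec_Z) for `k² → ∞` one
obtains `∫₀^∞ dm² ρ(m², μ² < ∞, g > 0) = 0`".
[cite: AlkoferVonSmekal2001, §2.3 (superconvergence relation)] [cite: OehmeZimmermann1980b, title (as [Oeh80] of the review)] -/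
def IsSuperconvergent (Z : ℝ → ℝ) : Prop :=
  Tendsto Z atTop (𝓝 0)

/-- **Superconvergence empties a positive finite spectral measure (proved).** If `Z` is
superconvergent and `Z(k²) = ∫ dρ k²/(k² + m²)` for `k² > 0` with `ρ` finite and carried by
`m² ≥ 0`, then `ρ = 0` — "the spectral density cannot be positive".
[cite: AlkoferVonSmekal2001, §2.3] -/
theorem measure_eq_zero_of_isSuperconvergent {Z : ℝ → ℝ} (hZ : IsSuperconvergent Z)
    {ρ : Measure ℝ} [IsFiniteMeasure ρ] (hsupp : ρ (Iio 0) = 0)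
    (hrep : ∀ k2, 0 < k2 → Z k2 = klDressing ρ k2) : ρ = 0 := by
  have h1 : Tendsto (klDressing ρ) atTop (𝓝 0) := by
    refine hZ.congr' ?_
    filter_upwards [eventually_gt_atTop 0] with k2 hk using hrep k2 hk
  have h2 := tendsto_klDressing ρ hsupp
  have h3 : ρ.real univ = 0 := tendsto_nhds_unique h2 h1
  rw [measureReal_def, ENNReal.toReal_eq_zero_iff] at h3
  rcases h3 with h3 | h3
  · exact Measure.measure_univ_eq_zero.mp h3
  · exact absurd h3 (measure_ne_top ρ univ)

/-- **The barrier theorem (proved): superconvergence excludes the technique class** — a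
superconvergent dressing function is not the dressing of any non-zero positive finite spectral
measure. [cite: AlkoferVonSmekal2001, §2.3] -/
theorem not_hasPositiveKallenLehmann_of_isSuperconvergent {Z : ℝ → ℝ} (hZ : IsSuperconvergent Z) :
    ¬ HasPositiveKallenLehmann Z := by
  rintro ⟨ρ, hfin, hsupp, hne, hrep⟩
  exact hne (measure_eq_zero_of_isSuperconvergent hZ hsupp hrep)

/-! ### Non-vacuity: the massive free (one-particle) dressing function is in the class; the
asymptotically free leading-log dressing function is superconvergent -/

/-- The dressing function of a single massive pole, `Z(k²) = k²/(k² + M²)` (propagator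
`1/(k² + M²)`, spectral measure `δ_{M²}`): a free massive — "Higgsed" or Proca — vector boson.
[folklore] -/
def massivePoleDressing (M2 : ℝ) (k2 : ℝ) : ℝ := k2 / (k2 + M2)

/-- The single massive pole is the dressing of the Dirac spectral measure at `M²`. [folklore] -/
theorem klDressing_dirac (M2 k2 : ℝ) : klDressing (Measure.dirac M2) k2 = massivePoleDressing M2 k2 := by
  simp [klDressing, massivePoleDressing, integral_dirac]

/-- **Non-vacuity — members of the class**: a massive (or massless) free vector boson with
positive residue, `Z(k²) = k²/(k² + M²)`, `M² ≥ 0`, has the positive finite Källén–Lehmann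
measure `δ_{M²}`; this is exactly the "massive physical vector-state" situation of the Higgs
mechanism, where the superconvergence derivation does not apply.
[cite: AlkoferVonSmekal2001, §2.3 (end: Higgs-mechanism exception [Nis96])] -/
theorem hasPositiveKallenLehmann_massivePole {M2 : ℝ} (hM : 0 ≤ M2) :
    HasPositiveKallenLehmann (massivePoleDressing M2) := by
  refine ⟨Measure.dirac M2, inferInstance, ?_, ?_, fun k2 _ => (klDressing_dirac M2 k2).symm⟩
  · rw [Measure.dirac_apply' _ measurableSet_Iio, Set.indicator_of_notMem (by simpa using hM)]
  · intro h
    have := congrArg (fun μ : Measure ℝ => μ univ) h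
    simp at this

/-- … and it is NOT superconvergent: `k²/(k² + M²) → 1 ≠ 0`. [folklore] -/
theorem not_isSuperconvergent_massivePole {M2 : ℝ} (hM : 0 ≤ M2) :
    ¬ IsSuperconvergent (massivePoleDressing M2) := by
  intro h
  have h1 : Tendsto (massivePoleDressing M2) atTop (𝓝 1) := tendsto_klIntegrand hM
  have := tendsto_nhds_unique h h1
  norm_num at this

/-- **The asymptotically free leading-logarithmic dressing function is superconvergent
(proved)**: for every exponent `γ > 0` and normalisation `C`, `C (ln k²)^{−γ} → 0` as `k² → ∞`
— the leading-log shape of the Landau-gauge gluon renormalisation function governed by "the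
same positive (for `N_f < 10`) anomalous dimension of the gluon field" `γ`, `1 > γ > 0`.
[cite: AlkoferVonSmekal2001, §2.3 ("1 > γ > 0 for N_f < 10"; leading logarithmic behaviour of Z)] -/
theorem isSuperconvergent_log_rpow_neg {γ : ℝ} (hγ : 0 < γ) (C : ℝ) :
    IsSuperconvergent fun k2 : ℝ => C * (Real.log k2) ^ (-γ) := by
  have h : Tendsto (fun k2 : ℝ => (Real.log k2) ^ (-γ)) atTop (𝓝 0) :=
    (tendsto_rpow_neg_atTop hγ).comp Real.tendsto_log_atTop
  unfold IsSuperconvergent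
  simpa using h.const_mul C

/-- Hence NO non-zero positive finite Källén–Lehmann measure reproduces the asymptotically
free dressing function, whatever the normalisation `C`. [cite: AlkoferVonSmekal2001, §2.3] -/
theorem not_hasPositiveKallenLehmann_log_rpow_neg {γ : ℝ} (hγ : 0 < γ) (C : ℝ) :
    ¬ HasPositiveKallenLehmann fun k2 : ℝ => C * (Real.log k2) ^ (-γ) :=
  not_hasPositiveKallenLehmann_of_isSuperconvergent (isSuperconvergent_log_rpow_neg hγ C)

/-- **Barrier (Oehme–Zimmermann superconvergence, 1980; Alkofer–von Smekal 2001 §2.3).**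
(i) No superconvergent dressing function is the dressing of a non-zero positive finite
Källén–Lehmann measure; (ii) in particular the asymptotically free shape `C (ln k²)^{−γ}`,
`γ > 0`, is not.

technique_class: positive-kallen-lehmann-gluon-propagator, massive-gluon-pole-in-positive-state-space, transverse-gluon-as-physical-particle, gluon-mass-generation-with-positive-spectral-function, kallen-lehmann-positivity-for-gauge-fixed-gluon
blocks: realising the `YangMills` (or `QCD`) mass gap naively as a massive transverse gluon: a one-particle pole of the Landau- or linear-covariant-gauge gluon propagator in a positive (semi-definite) physical state space, i.e. a Källén–Lehmann representation of the gluon dressing function by a non-zero POSITIVE finite spectral measure (as for a Proca or Higgsed vector boson: `hasPositiveKallenLehmann_massivePole`) — in an asymptotically free theory, where the dressing function is superconvergent [cite: AlkoferVonSmekal2001, §2.3] [cite: OehmeZimmermann1980a, title] [cite: OehmeZimmermann1980b, title]. [audit 2026-08-14, READ "Landau- or linear-covariant-gauge" as "Landau gauge, printed `ξ ≤ 0`" — for `ξ > 0` the dressing function tends to `ξ/ξ₀ ≠ 0` and is not superconvergent (scope_caveats (ii), evasion (f)); and READ "i.e." as "the ENTIRE spectral measure positive" — a positive-residue pole with compensating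 negative weight is not blocked (scope_caveats (v), evasion (e)); corrected record: `OehmeZimmermannSuperconvergenceNarrow`.]
because: a positive finite spectral measure is recovered as the ultraviolet limit of its dressing function, `Z(k²) = ∫ dρ k²/(k²+m²) → ∫ dρ` (dominated convergence; proved: `tendsto_klDressing`), whereas asymptotic freedom — antiscreening, `Z₃⁻¹ → 0`, anomalous dimension `1 > γ > 0` for `N_f < 10` in Landau gauge — makes the renormalised gluon dressing function at fixed finite `μ²` vanish as `k² → ∞`, "`∫₀^∞ dm² ρ(m², μ² < ∞, g > 0) = 0`" (the Oehme–Zimmermann superconvergence relation) [cite: AlkoferVonSmekal2001, §2.3]; the two limits force `ρ = 0` (proved: `measure_eq_zero_of_isSuperconvergent`), and the leading-log shape `C(ln k²)^{−γ}` is indeed superconvergent for every `γ > 0` (proved: `isSuperconvergent_log_rpow_neg`); in all linear covariant gauges moreover `ρ(k²) → −γ C_R k⁻²(ln k²/μ²)^{−γ−1} < 0` asymptotically [cite: AlkoferVonSmekal2001, §2.3 (citing [Oeh90, Oeh94])].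
evasions_known: (a) give up positivity: "Covariant quantum theories of gauge fields require indefinite metric spaces" — positivity violation of transverse gluons is then read as a manifestation of confinement, the gluons joining unphysical BRST quartets (Kugo–Ojima) [cite: AlkoferVonSmekal2001, §2.4 and §2.3 (end)]; (b) Higgs mechanism: the necessary condition of the derivation (unbroken global gauge symmetry, no massless states in the global current) "is violated in models with Higgs mechanism which prevents one from concluding a positivity violation of the massive physical vector-states" [cite: AlkoferVonSmekal2001, §2.3 (end, [Nis96])] — cf. `hasPositiveKallenLehmann_massivePole`; (c) gauge-invariant formulations (Wilson loops, local gauge-invariant composite fields, the Osterwalder–Schrader route of the Clay problem) make no statement about the gluon propagator and are untouched by the entry; (d) [corrected by audit 2026-08-14] giving up FINITENESS of the spectral weight is not by itself an evasion: any positive measure on `m² ≥ 0` whose unsubtracted integral converges (`∫ dρ/(1+m²) < ∞`) and whose dressing is superconvergent vanishes (proved: `measure_eq_zero_of_isSuperconvergent_of_integrable`); only a genuinely divergent, subtracted representation leaves the formal class, and the printed argument derives the UNSUBTRACTED representation from the asymptotic bounds in all complex directions — "The bounds obtained from the asymptotic expressions, together with the analytic properties of the structure functions, generally lead to un-subtracted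 dispersion representations" [cite: Xu1996, Abstract and §2.3] (naive versus renormalised sum rule: [cite: AlkoferVonSmekal2001, §2.3]); (e) [audit 2026-08-14] a POSITIVE-RESIDUE MASSIVE POLE WITH COMPENSATING NEGATIVE CONTINUUM: the printed relation is "`Z + ∫ dκ² ρ̃(κ²) = 0`" with the one-particle residue `Z` separated [cite: AlkoferVonSmekal2001, §2.3 (eq. (OZ))], a constraint on the TOTAL signed weight only (`isSuperconvergent_klDressing_sub_iff`); `σ([0,∞))·k²/(k²+M²) − ∫ dσ k²/(k²+m²)` is superconvergent for every finite `σ ≥ 0` on `m² ≥ 0` (`isSuperconvergent_pole_sub_klDressing`) — the shape extracted from `SU(3)` lattice data, "negative-definite for all the region of ω > m, except for the positive δ-functional peak at ω = m" [cite: IritaniSuganumaIida2009, Abstract and §6.3], and of the functional reconstructions, for which the relation "entails that ρ_A(λ) has positive and negative values" around a "main positive peak" [cite: CyrolEtAl2018, §3 and §5.4]; (f) [audit 2026-08-14] linear covariant gauges `ξ > 0`: "`−k²D → α/α₀` for `k² → ∞` in all directions, and hence we obtain from the unsubtracted dispersion relation … the sum rule `∫ dk² ρ = α/α₀`. This is the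 generalization of the superconvergence relation", `α₀ = (4/9)(39/4 − N_F)` [cite: Xu1996, §2.2–§2.3]; "the Landau gauge considered so far is exceptional (`ξ = 0`), and … for other possible choices of the gauge parameter `ξ` … the superconvergence relation might not rule out positivity anyway. The generalisation of the Oehme–Zimmermann argument to the whole family of linear covariant gauges is less obvious" [cite: AlkoferVonSmekal2001, §2.3] — every positive total weight is attained inside the positive class (`exists_hasPositiveKallenLehmann_tendsto`), and non-positivity for `ξ > 0` rests instead on the asymptotic sign of the discontinuity, "Assuming that the only singularities of the gluon propagator lie on the time-like real axis" [cite: AlkoferVonSmekal2001, §2.3]; (g) [audit 2026-08-14] complex-conjugate poles (Gribov–Stingl fits, refined Gribov–Zwanziger, the massive Yang–Mills model at one loop) leave the Källén–Lehmann form altogether and change the sum rule to "`2 Re Z + ∫ dσ² ρ(σ²) = 0`": "the usual superconvergence relation does not hold unless the residue of the complex pole is pure imaginary" [cite: KondoEtAl2020, §6]; (h) [audit 2026-08-14] the renormalisation-point ambiguity flagged by the review itself: "The contradiction with positivity from the superconvergence relation could be avoided at this stage by supplying the definition of the asymptotic subtraction scheme with an implicit limit `μ → ∞`" [cite: AlkoferVonSmekal2001,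 §2.3].
scope_caveats: (i) PROVED here: the measure-theoretic core and the superconvergence of the asymptotically free leading-log shape; that the ACTUAL Landau-gauge gluon dressing function of `YangMills`/`QCD` is superconvergent (`Z(k², μ²) → 0` at fixed finite `μ²`, `1 > γ > 0` for `N_f < 10`) is the perturbative renormalisation-group input, recorded as printed [cite: AlkoferVonSmekal2001, §2.3] from [cite: OehmeZimmermann1980b, title (not consulted)], and the review itself flags "points in this argument which might be regarded as not absolutely conclusive" [cite: AlkoferVonSmekal2001, §2.1]; (ii) [sharpened by audit 2026-08-14] a gauge-FIXED statement about the elementary gluon field in LANDAU gauge — the printed sum rule is `0` for `ξ ≤ 0` and `ξ/ξ₀` for `ξ > 0` [cite: AlkoferVonSmekal2001, §2.3 (eq. (OZ))] [cite: Xu1996, §2.3], so conjunct (i) applies to `ξ ≤ 0` only (evasion (f)); it DOES extend to the gauge-invariant pinch-technique / background-Feynman-gauge propagator, which "vanishes faster than `1/p²`, just as the Landau-gauge propagator does, and … [has] the spectral function satisfying the superconvergence relation … with a non-positive spectral function, corresponding to `A = 1`" [cite: Cornwall2013, §2.2] ("Asymptotic freedom alone demands non-positivity and superconvergence" [cite: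 Cornwall2013, Abstract]); nothing is said about gauge-invariant local correlators (Wilson loops, composite fields), nor about whether transverse gluon correlations are gapped ("For the realization of confinement it is necessary in addition that there is a mass gap in the transverse gluon correlations" [cite: AlkoferVonSmekal2001, §2.3 (end)]); (iii) the formal class takes non-zero positive FINITE measures carried by `m² ≥ 0` with the unsubtracted representation; finiteness is not load-bearing — `∫ dρ/(1+m²) < ∞` suffices (`measure_eq_zero_of_isSuperconvergent_of_integrable`; for `k² ≥ 1`, `k²/(k²+m²) ≥ 1/(1+m²)`) — and is kept in `HasPositiveKallenLehmann` because without an integrability clause `klDressing` would return the junk Bochner value `0` for non-integrable kernels; (iv) `N_f < 10` is the `SU(3)`-fundamental count (`γ₀₀ ∝ −(13/2 − 2N_F/3)`, `α₀ = (4/9)(39/4 − N_F)` [cite: Xu1996, §2.1–§2.2]); in general the condition is `0 < γ₀₀/β₀`, i.e. `N_F < 13N_C/4` fundamental flavours with `β₀ < 0`, so pure Yang–Mills (`N_f = 0`, `γ = 13/22` [cite: CyrolEtAl2018, §3]) is covered for every gauge group; at `γ₀₀ = 0` the sum rule reads `∫ρ = R(0; g², 0) > 0` and for `γ₀₀/β₀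 < 0` (`10 ≤ N_f ≤ 16` in `SU(3)`) "It is not valid" [cite: Xu1996, §2.3] — nothing is claimed there; (v) [audit 2026-08-14 — NARROWED, see `OehmeZimmermannSuperconvergenceNarrow`] the technique-class tokens `massive-gluon-pole-in-positive-state-space` and `transverse-gluon-as-physical-particle` are covered ONLY in the strong reading "the ENTIRE gauge-fixed gluon two-point function is that of a positive-metric field" (total positivity of the spectral measure): a positive-residue massive one-particle pole coexisting with negative spectral weight elsewhere is superconvergent and NOT excluded (evasion (e)); what speaks against positive spectral weight at the bottom of the pure Yang–Mills gluon spectrum (long-distance negativity of lattice and Dyson–Schwinger Schwinger functions [cite: AlkoferVonSmekal2001, §5.3.4] [cite: Cornwall2013, Abstract]; the negative infra-red asymptotics of the Landau-gauge spectral function [cite: CyrolEtAl2018, §4]) is separate evidence, not this entry; the confinement READING of the relation is contested — the continuous non-positivity "can only arise from the component ρ̃₂(s), which has vanishing integral", as for the photon in QED, which "casts doubt on the hypothesis that these violations in Landau gauge are the reason why gluons are absent from the spectrum" [cite: Lowdon2018, §2]; and in lattice Yang–Mills–Higgs theory the Landau-gauge `W` space-time correlator is positive and decays "like a massive particle" at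 long times in the Higgs-like domain, its effective mass approaching the plateau "from below, instead of above. This is not possible for a physical particle" — i.e. a positive massive level plus negative short-distance spectral weight, exactly the shape of evasion (e) — while in the QCD-like domain it shows the positivity-violating zero-crossing; all propagators share the logarithmically corrected ultraviolet behaviour [cite: MaasMufti2014, §4.1]; (vi) [audit 2026-08-14] the perturbative-RG input of (i) rests on `β₀ < 0`, no zero of `β` on `(0, g²]`, analyticity in the cut `k²`-plane and "the assumption that the exact Green's functions are connected to expansions in perturbation theory as the coupling constant approaches zero" [cite: Xu1996, §2 (opening) and §2.1]; Landau gauge itself carries the Gribov-copy / zero-mode reservations of the review [cite: AlkoferVonSmekal2001, §2.2 (end)], and the axial-gauge "resolution of the Oehme–Zimmermann paradox proposed in Ref. [Wes83] is most likely itself based on the presence of negative norm states. It is thus inconclusive" [cite: AlkoferVonSmekal2001, §5.2.3].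
status: established (measure-theoretic core and superconvergence of the asymptotic shape proved here; the superconvergence relation itself is the perturbative-RG theorem of OehmeZimmermann1980a/b as reviewed in AlkoferVonSmekal2001 §2.3, with the review's reservation cited in scope_caveats (i)); technique class narrowed and caveats sharpened by barrier audit 2026-08-14 (`OehmeZimmermannSuperconvergenceNarrow`, proved)

[cite: AlkoferVonSmekal2001, §2.3] [cite: OehmeZimmermann1980b, title] -/
def OehmeZimmermannSuperconvergence : Prop :=
  (∀ Z : ℝ → ℝ, IsSuperconvergent Z → ¬ HasPositiveKallenLehmann Z) ∧
    ∀ γ : ℝ, 0 < γ → ∀ C : ℝ, ¬ HasPositiveKallenLehmann fun k2 : ℝ => C * (Real.log k2) ^ (-γ)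

/-- **Proof of the barrier.** [folklore] -/
theorem OehmeZimmermannSuperconvergence_holds : OehmeZimmermannSuperconvergence :=
  ⟨fun _ hZ => not_hasPositiveKallenLehmann_of_isSuperconvergent hZ,
    fun _ hγ C => not_hasPositiveKallenLehmann_log_rpow_neg hγ C⟩

/-! ### Barrier audit (D-0021, 2026-08-14): superconvergence pins the total signed weight —
sharpness of the technique class, and removability of the finiteness hypothesis -/

/-- **Finiteness is not load-bearing (proved).** If `Z` is superconvergent and, for `k² > 0`,
`Z(k²) = ∫ dρ k²/(k² + m²)` with `ρ` ANY positive measure carried by `m² ≥ 0` whose unsubtracted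
integral converges, `∫ dρ(m²)/(1 + m²) < ∞`, then `ρ = 0`: for `k² ≥ 1` one has
`k²/(k² + m²) ≥ 1/(1 + m²)`, so `Z(k²) ≥ ∫ dρ/(1 + m²) > 0` unless `ρ = 0`. This is the
monotonicity form of the printed argument ("`D` … vanishes faster than `1/p²` near infinity,
which manifestly contradicts the representation … if `ρ` is positive").
[cite: Cornwall2013, §2.1] -/
theorem measure_eq_zero_of_isSuperconvergent_of_integrable {Z : ℝ → ℝ} (hZ : IsSuperconvergent Z)
    {ρ : Measure ℝ} (hsupp : ρ (Iio 0) = 0) (hint : Integrable (fun m2 : ℝ => (1 + m2)⁻¹) ρ)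
    (hrep : ∀ k2, 0 < k2 → Z k2 = klDressing ρ k2) : ρ = 0 := by
  have hae : ∀ᵐ m2 ∂ρ, 0 ≤ m2 := by
    rw [ae_iff]
    have : {a : ℝ | ¬ 0 ≤ a} = Iio 0 := by ext a; simp [not_le]
    rw [this]
    exact hsupp
  set I : ℝ := ∫ m2, (1 + m2)⁻¹ ∂ρ with hI
  have hlow : ∀ k2, 1 ≤ k2 → I ≤ klDressing ρ k2 := by
    intro k2 hk
    have hk0 : 0 < k2 := by linarith
    have hint2 : Integrable (fun m2 : ℝ => k2 / (k2 + m2)) ρ := by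
      refine Integrable.mono' (hint.const_mul k2) ?_ ?_
      · exact (measurable_const.div (measurable_const.add measurable_id)).aestronglyMeasurable
      · filter_upwards [hae] with m2 hm
        have h1 : 0 < k2 + m2 := by linarith
        have h2 : 0 < 1 + m2 := by linarith
        rw [Real.norm_eq_abs, abs_of_nonneg (div_nonneg hk0.le h1.le), ← div_eq_mul_inv]
        exact div_le_div_of_nonneg_left hk0.le h2 (by linarith)
    refine integral_mono_ae hint hint2 ?_
    filter_upwards [hae] with m2 hm
    have h1 : 0 < k2 + m2 := by linarith
    have h2 : 0 < 1 + m2 := by linarith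
    rw [inv_eq_one_div, div_le_div_iff₀ h2 h1]
    nlinarith
  have hZ' : Tendsto (klDressing ρ) atTop (𝓝 0) := by
    refine hZ.congr' ?_
    filter_upwards [eventually_gt_atTop 0] with k2 hk using hrep k2 hk
  have hIle : I ≤ 0 :=
    ge_of_tendsto hZ' (by filter_upwards [eventually_ge_atTop 1] with k2 hk using hlow k2 hk)
  have hpos : ∀ᵐ m2 ∂ρ, 0 < (1 + m2)⁻¹ := by
    filter_upwards [hae] with m2 hm using inv_pos.mpr (by linarith)
  have hIge : 0 ≤ I := integral_nonneg_of_ae (hpos.mono fun _ h => h.le)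
  have hI0 : I = 0 := le_antisymm hIle hIge
  have h0 : (fun m2 : ℝ => (1 + m2)⁻¹) =ᵐ[ρ] 0 :=
    (integral_eq_zero_iff_of_nonneg_ae (hpos.mono fun _ h => h.le) hint).mp hI0
  have hfalse : ∀ᵐ m2 ∂ρ, False := by
    filter_upwards [h0, hpos] with m2 h1 h2
    rw [h1] at h2
    exact lt_irrefl _ h2
  exact ae_eq_bot.mp (eventually_false_iff_eq_bot.mp hfalse)

/-- **Signed Källén–Lehmann dressing: the ultraviolet limit is the total SIGNED weight.** For
finite measures `ρ₊, ρ₋` carried by `m² ≥ 0` (positive and negative parts of an indefinite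
spectral function, as for a field in an indefinite-metric covariant gauge),
`∫ dρ₊ k²/(k²+m²) − ∫ dρ₋ k²/(k²+m²) → ρ₊([0,∞)) − ρ₋([0,∞))`. [folklore] -/
theorem tendsto_klDressing_sub (ρp ρm : Measure ℝ) [IsFiniteMeasure ρp] [IsFiniteMeasure ρm]
    (hp : ρp (Iio 0) = 0) (hm : ρm (Iio 0) = 0) :
    Tendsto (fun k2 => klDressing ρp k2 - klDressing ρm k2) atTop
      (𝓝 (ρp.real univ - ρm.real univ)) :=
  (tendsto_klDressing ρp hp).sub (tendsto_klDressing ρm hm)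

/-- **The Oehme–Zimmermann relation as an equivalence (proved).** For a signed spectral
function with finite positive and negative parts carried by `m² ≥ 0`, the dressing function is
superconvergent IFF the total signed weight vanishes, `ρ₊([0,∞)) = ρ₋([0,∞))` — the printed
"`Z + ∫_{m²}^∞ dκ² ρ̃(κ²) = 0`" (one-particle residue `Z` separated, continuum `ρ̃` of either
sign) read as what it is: a constraint on the TOTAL weight, silent about the sign of any part.
[cite: AlkoferVonSmekal2001, §2.3 (eq. (OZ), ξ ≤ 0)] -/
theorem isSuperconvergent_klDressing_sub_iff (ρp ρm : Measure ℝ) [IsFiniteMeasure ρp]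
    [IsFiniteMeasure ρm] (hp : ρp (Iio 0) = 0) (hm : ρm (Iio 0) = 0) :
    IsSuperconvergent (fun k2 => klDressing ρp k2 - klDressing ρm k2) ↔
      ρp.real univ = ρm.real univ := by
  have h := tendsto_klDressing_sub ρp ρm hp hm
  constructor
  · intro h0
    have := tendsto_nhds_unique h h0
    linarith
  · intro heq
    unfold IsSuperconvergent
    rw [show ρp.real univ - ρm.real univ = 0 by linarith] at h
    exact h

/-- **A positive-residue massive one-particle pole is NOT excluded by superconvergence
(proved).** For `M² ≥ 0` and any finite `σ ≥ 0` carried by `m² ≥ 0`, the dressing function of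
the signed measure `σ([0,∞))·δ_{M²} − σ` — a transverse pole at `k² = −M²` with POSITIVE residue
`σ([0,∞))` on top of a continuum of NEGATIVE spectral weight — is superconvergent. This is the
shape of the Landau-gauge gluon spectral function extracted from `SU(3)` lattice data, "almost
negative-definite for ω > m, except for a positive δ-functional peak at ω = m", and of the
functional reconstructions obeying the superconvergence relation around a "main positive peak".
[cite: IritaniSuganumaIida2009, Abstract and §6.3] [cite: CyrolEtAl2018, §3 and §5.4] -/
theorem isSuperconvergent_pole_sub_klDressing {M2 : ℝ} (hM : 0 ≤ M2) (σ : Measure ℝ)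
    [IsFiniteMeasure σ] (hσ : σ (Iio 0) = 0) :
    IsSuperconvergent fun k2 => σ.real univ * massivePoleDressing M2 k2 - klDressing σ k2 := by
  have h1 : Tendsto (fun k2 => σ.real univ * massivePoleDressing M2 k2) atTop
      (𝓝 (σ.real univ * 1)) :=
    (tendsto_klIntegrand hM).const_mul _
  have h2 := tendsto_klDressing σ hσ
  have := h1.sub h2
  unfold IsSuperconvergent
  simpa using this

/-- The simplest instance: `Z(k²) = k²/(k² + M²) − k²/(k² + M'²)`, the dressing of
`δ_{M²} − δ_{M'²}` (unit positive residue at `M²`, unit negative weight at `M'²`; `M², M'² ≥ 0`),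
is superconvergent — a "massive gluon" pole with positive residue and total spectral weight zero.
[folklore] -/
theorem isSuperconvergent_massivePole_sub_massivePole {M2 M2' : ℝ} (hM : 0 ≤ M2)
    (hM' : 0 ≤ M2') :
    IsSuperconvergent fun k2 => massivePoleDressing M2 k2 - massivePoleDressing M2' k2 := by
  have := (tendsto_klIntegrand hM).sub (tendsto_klIntegrand hM')
  unfold IsSuperconvergent
  simpa [massivePoleDressing] using this

/-- `c·k²/(k² + M²)` with `c > 0`, `M² ≥ 0` is in the positive class (measure `c·δ_{M²}`): a
massive vector pole of residue `c`. [folklore] -/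
theorem hasPositiveKallenLehmann_const_mul_massivePole {c M2 : ℝ} (hc : 0 < c) (hM : 0 ≤ M2) :
    HasPositiveKallenLehmann fun k2 => c * massivePoleDressing M2 k2 := by
  refine ⟨c.toNNReal • Measure.dirac M2, inferInstance, ?_, ?_, ?_⟩
  · rw [Measure.smul_apply, Measure.dirac_apply' _ measurableSet_Iio,
      Set.indicator_of_notMem (by simpa using hM)]
    simp
  · intro h
    have := congrArg (fun μ : Measure ℝ => μ univ) h
    simp at this
    linarith
  · intro k2 _
    rw [klDressing, integral_smul_nnreal_measure, ← klDressing, klDressing_dirac, NNReal.smul_def,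
      smul_eq_mul, Real.coe_toNNReal _ hc.le]

/-- **The generalised sum rule of the `ξ > 0` linear covariant gauges is no obstruction to
positivity (proved).** Every ultraviolet limit / total weight `c > 0` — e.g. `c = ξ/ξ₀`, the
printed "`−k²D → α/α₀` for `k² → ∞` in all directions, and hence … the sum rule
`∫ dk² ρ = α/α₀`", `α₀ = (4/9)(39/4 − N_F)`, of the gauges `α = ξ > 0` — is attained INSIDE
the positive class (`c·k²/(k² + 1)`, measure `c·δ₁`). Hence conjunct (i) of the barrier says
nothing for `ξ > 0`; there non-positivity rests on the asymptotic sign of the discontinuity.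
[cite: Xu1996, §2.2–§2.3] [cite: AlkoferVonSmekal2001, §2.3 ("the Landau gauge considered so far is exceptional")] -/
theorem exists_hasPositiveKallenLehmann_tendsto {c : ℝ} (hc : 0 < c) :
    ∃ Z : ℝ → ℝ, HasPositiveKallenLehmann Z ∧ Tendsto Z atTop (𝓝 c) := by
  refine ⟨fun k2 => c * massivePoleDressing 1 k2,
    hasPositiveKallenLehmann_const_mul_massivePole hc zero_le_one, ?_⟩
  have := (tendsto_klIntegrand (zero_le_one' ℝ)).const_mul c
  simpa [massivePoleDressing] using this

/-- A dressing function with a NON-ZERO ultraviolet limit (as printed for `ξ > 0`: `ξ/ξ₀`) is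
not superconvergent. [folklore] -/
theorem not_isSuperconvergent_of_tendsto_ne_zero {Z : ℝ → ℝ} {c : ℝ} (hc : c ≠ 0)
    (hZ : Tendsto Z atTop (𝓝 c)) : ¬ IsSuperconvergent Z := fun h =>
  hc (tendsto_nhds_unique hZ h)

/-- **Barrier `OehmeZimmermannSuperconvergence` — NARROWED technique class (barrier audit
D-0021, 2026-08-14): superconvergence pins the total signed spectral weight and nothing else.**
Conjunction of (1) the landed barrier `OehmeZimmermannSuperconvergence` (a superconvergent
dressing function is the dressing of no non-zero POSITIVE finite measure; the asymptotically
free shape `C(ln k²)^{−γ}`, `γ > 0`, is superconvergent) with three sharpness statements, all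
proved: (2) for finite `ρ₊, ρ₋` carried by `m² ≥ 0` the signed dressing
`∫ dρ₊ k²/(k²+m²) − ∫ dρ₋ k²/(k²+m²)` is superconvergent IFF `ρ₊([0,∞)) = ρ₋([0,∞))` — the
printed relation "`Z + ∫ dκ² ρ̃(κ²) = 0`" [cite: AlkoferVonSmekal2001, §2.3 (eq. (OZ))] is a
constraint on the TOTAL weight; (3) hence for every `M² ≥ 0` and finite `σ ≥ 0` on `m² ≥ 0`,
`σ([0,∞))·k²/(k²+M²) − ∫ dσ k²/(k²+m²)` — a transverse one-particle pole with POSITIVE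
residue over a continuum of NEGATIVE weight — is superconvergent: the massive pole with
positive residue is not excluded, only TOTAL positivity is; (4) for every `c > 0` some member
of the positive class tends to `c` (`c·k²/(k²+M²)`, measure `c·δ_{M²}`): the generalised sum
rule `∫ρ = ξ/ξ₀` of the linear covariant gauges `ξ > 0` [cite: Xu1996, §2.3] is satisfiable
inside the positive class, so conjunct (i) of (1) is void there.

technique_class: kallen-lehmann-total-positivity-for-landau-gauge-gluon, positive-kallen-lehmann-gluon-propagator (READ: the ENTIRE two-point function of the elementary gauge-fixed gluon field is that of a positive-metric field — a positive spectral MEASURE, finite or with convergent unsubtracted integral — in Landau gauge, printed `ξ ≤ 0`, or for the pinch-technique / background-Feynman-gauge propagator), gluon-mass-generation-with-positive-spectral-function (same reading: positive EVERYWHERE, including the ultraviolet tail), kallen-lehmann-positivity-for-gauge-fixed-gluon (same reading; the gauges `ξ > 0` are NOT reached by superconvergence), massive-gluon-pole-in-positive-state-space and transverse-gluon-as-physical-particle ONLY in the reading "every state the gauge-fixed transverse gluon field creates from the vacuum has positive norm", NOT in the reading "the propagator has a real pole with positive residue"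
blocks: what (1) blocks, restricted to its actual content: representing the Landau-gauge (`ξ ≤ 0`) — or pinch-technique — gluon dressing function of an asymptotically free gauge theory with `0 < γ₀₀/β₀` (`N_F < 13N_C/4` fundamental flavours; `N_f ≤ 9` for `SU(3)`) by a non-zero POSITIVE spectral measure, i.e. treating the gauge-fixed gluon field as a positive-metric (Wightman) field — in particular "mass gap = free massive (Proca-like) gluon with positive Källén–Lehmann measure" [cite: AlkoferVonSmekal2001, §2.3] [cite: Cornwall2013, §2.1–§2.2]; it does NOT block (α) a GAPPED transverse-gluon correlator whose spectral function changes sign — a positive-residue massive pole, or a positive quasi-particle peak, compensated by negative weight elsewhere (conjuncts (2)–(3); [cite: IritaniSuganumaIida2009, Abstract] [cite: CyrolEtAl2018, §3 and §5.4]) — which is the working picture of the gauge-fixed lattice / Dyson–Schwinger / functional-RG literature, constrained by this entry only through `∫ρ = 0`; (β) positivity claims in linear covariant gauges `ξ > 0`, where only the asymptotic sign of the discontinuity, under a cut-plane analyticity assumption, is available (conjunct (4); [cite: AlkoferVonSmekal2001, §2.3] [cite: Xu1996, §2.3]); (γ) anything gauge-invariant and local (Wilson loops, composite operators, the Osterwalder–Schrader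 route of the Clay problem); (δ) theories with `γ₀₀/β₀ ≤ 0`.
because: (1) is `OehmeZimmermannSuperconvergence_holds`; (2): both dressings converge to their total weights by dominated convergence (`tendsto_klDressing`), so the difference tends to `ρ₊([0,∞)) − ρ₋([0,∞))`, and limits in `ℝ` are unique (`isSuperconvergent_klDressing_sub_iff`); (3) is (2) with `ρ₊ = σ([0,∞))·δ_{M²}` (`isSuperconvergent_pole_sub_klDressing`; simplest instance `δ_{M²} − δ_{M'²}`: `isSuperconvergent_massivePole_sub_massivePole`); (4): `c·δ_{M²}` is a non-zero positive finite measure with dressing `c·k²/(k²+M²) → c` (`hasPositiveKallenLehmann_const_mul_massivePole`, `exists_hasPositiveKallenLehmann_tendsto`), and a dressing function with non-zero limit is not superconvergent (`not_isSuperconvergent_of_tendsto_ne_zero`), matching the printed `ξ > 0` asymptotics "`−k²D → α/α₀`", `α₀ = (4/9)(39/4 − N_F)` [cite: Xu1996, §2.2–§2.3]; in the opposite direction the finiteness hypothesis of (1) is removable (`measure_eq_zero_of_isSuperconvergent_of_integrable`).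
evasions_known: (a)–(h) of `OehmeZimmermannSuperconvergence` as amended by this audit; in particular the gauge-fixed functional / lattice picture — a GAPPED, sign-changing Landau-gauge gluon spectral function with negative infra-red and ultraviolet asymptotics around a "main positive peak", which "satisfies the Oehme-Zimmermann superconvergence relation, has the correct low and high frequency asymptotics, and reproduces the Euclidean gluon propagator data" [cite: CyrolEtAl2018, §4 and §6], or "a positive δ-functional peak at ω = m" over a negative continuum [cite: IritaniSuganumaIida2009, Abstract and §6.3] — lies inside conjunct (3) and outside conjunct (1); the lattice Yang–Mills–Higgs `W` propagator — in the Higgs-like domain a positive space-time correlator decaying "like a massive particle" at long times whose effective mass approaches its plateau "from below, instead of above. This is not possible for a physical particle" (a positive massive level plus negative short-distance weight: the shape of conjunct (3)), in the QCD-like domain the positivity-violating zero-crossing, with common logarithmic ultraviolet behaviour [cite: MaasMufti2014, §4.1] — together with Nishijima's Higgs caveat [cite: AlkoferVonSmekal2001, §2.3 (end)] illustrates a physical massive vector pole coexisting with a gauge-fixed two-point function that is not that of a positive-metric field.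
scope_caveats: conjuncts (2)–(4) are statements about (signed) finite measures and their dressings, i.e. about what the ULTRAVIOLET LIMIT of a dressing function can and cannot detect; they do not assert that the Yang–Mills gluon HAS a positive-residue pole — the negative long-distance Schwinger functions of lattice and Dyson–Schwinger studies [cite: AlkoferVonSmekal2001, §5.3.4] [cite: Cornwall2013, Abstract] and the negative infra-red asymptotics of the Landau-gauge spectral function [cite: CyrolEtAl2018, §4] separately disfavour positive weight at the BOTTOM of the spectrum — nor that positivity holds for `ξ > 0` (the discontinuity is asymptotically negative there as well, granted cut-plane analyticity [cite: AlkoferVonSmekal2001, §2.3] [cite: Xu1996, §2.3]); the physics input "the Landau-gauge dressing function of `YangMills`/`QCD` is superconvergent" remains the perturbative-RG statement of caveat (i) of (1), resting on `β₀ < 0`, no zero of `β` on `(0, g²]`, cut-plane analyticity and "the assumption that the exact Green's functions are connected to expansions in perturbation theory as the coupling constant approaches zero" [cite: Xu1996, §2 (opening) and §2.1]; with complex singularities the sum rule itself changes ("`2 Re Z + ∫ dσ² ρ(σ²) = 0`" [cite: KondoEtAl2020, §6]) and with the admissible `δ(s)`-components of an indefinite-metric spectral density its confinement reading is contested [cite: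 Lowdon2018, §2]; caveats (i)–(vi) of (1) apply verbatim to conjunct (1).
status: theorem (all four conjuncts proved here: `OehmeZimmermannSuperconvergenceNarrow_holds`); narrowing of the technique class of `OehmeZimmermannSuperconvergence` (barrier audit D-0021, 2026-08-14)

[cite: AlkoferVonSmekal2001, §2.3] [cite: Xu1996, §2.2–§2.3] [cite: IritaniSuganumaIida2009, Abstract and §6.3] [cite: CyrolEtAl2018, §3 and §5.4] [cite: Cornwall2013, §2.1–§2.2] -/
def OehmeZimmermannSuperconvergenceNarrow : Prop :=
  OehmeZimmermannSuperconvergence ∧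
    (∀ ρp ρm : Measure ℝ, IsFiniteMeasure ρp → IsFiniteMeasure ρm → ρp (Iio 0) = 0 →
      ρm (Iio 0) = 0 →
        (IsSuperconvergent (fun k2 => klDressing ρp k2 - klDressing ρm k2) ↔
          ρp.real univ = ρm.real univ)) ∧
    (∀ M2 : ℝ, 0 ≤ M2 → ∀ σ : Measure ℝ, IsFiniteMeasure σ → σ (Iio 0) = 0 →
      IsSuperconvergent fun k2 => σ.real univ * massivePoleDressing M2 k2 - klDressing σ k2) ∧
    (∀ c : ℝ, 0 < c → ∃ Z : ℝ → ℝ, HasPositiveKallenLehmann Z ∧ Tendsto Z atTop (𝓝 c))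

/-- **Proof of the narrowed record**: (1) is `OehmeZimmermannSuperconvergence_holds`, (2) is
`isSuperconvergent_klDressing_sub_iff`, (3) is `isSuperconvergent_pole_sub_klDressing`, (4) is
`exists_hasPositiveKallenLehmann_tendsto`. [folklore] -/
theorem OehmeZimmermannSuperconvergenceNarrow_holds : OehmeZimmermannSuperconvergenceNarrow :=
  ⟨OehmeZimmermannSuperconvergence_holds,
    fun ρp ρm _ _ hp hm => isSuperconvergent_klDressing_sub_iff ρp ρm hp hm,
    fun _ hM σ _ hσ => isSuperconvergent_pole_sub_klDressing hM σ hσ,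
    fun _ hc => exists_hasPositiveKallenLehmann_tendsto hc⟩

/-- The narrowed record implies the landed barrier (its first conjunct). [folklore] -/
theorem OehmeZimmermannSuperconvergenceNarrow.toOehmeZimmermannSuperconvergence
    (h : OehmeZimmermannSuperconvergenceNarrow) : OehmeZimmermannSuperconvergence :=
  h.1

end Literature.Barriers.QuantumFields

end
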